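import Summits.MatrixMultiplication.OmegaCensus.STPP222IcosetWSearchPrims

/-!
# ω-census, icoset class negatives at 2-rank four: semantics of the witness-model engine, II (digit lists, triple summaries)

HONEST FRAMING (pub-omega census; verbatim): lottery ticket; floor = certified bounds/negative ranges.
Census STRUCTURE bookkeeping (Q7, the involution-coset class), nothing about `ω`.

Semantics of `STPP222IcosetWSearch.lean`, part II: digit lists (`AllDig`, the nibble fold `nibRec`/`nibFold`), the coset-representative
fold at the true point (`lamOf_mem`), the feasible-`ψ` mask (`feasF_spec`), the packed fields (`tiPack_fields`), the unfolded forms of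
`tripInfo`, and **`tripInfo_sound`**: for a triple whose recorded points lie on the true lines of an independent frame and whose
recorded `ψ` is `0` or the true one, the summary is alive, its `ψ'` is `0` or the true `ψ`, the true `ψ` is in the feasible mask, and
every point of the true line `X` is in the admissible mask `X`.  Part III: `STPP222IcosetWSearchSound.lean`.
Seat pub-omega-kernel-l4 (gen 20), 2026-08-27.
-/

namespace Summit.MatrixMultiplication.OmegaCensus

namespace IcosetW

open IcosetH (getI allN allN_true)

/-! ## Digit lists -/

/-- Every base-16 digit of `pl` below its length satisfies `P`. -/
def AllDig (P : ℕ → Prop) (pl : ℕ) : Prop := ∀ n, pl / 16 ^ n ≠ 0 → P (pl / 16 ^ n % 16)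

/-- The empty digit list. -/
theorem allDig_zero (P : ℕ → Prop) : AllDig P 0 := fun _ h => absurd (Nat.zero_div _) h

/-- Appending a digit. -/
theorem allDig_append {P : ℕ → Prop} {pl u : ℕ} (h : AllDig P pl) (hu : P u) (hu16 : u < 16) :
    AllDig P (pl * 16 + u) := by
  intro n hn
  cases n with
  | zero =>
    have e : (pl * 16 + u) / 16 ^ 0 % 16 = u := by rw [pow_zero, Nat.div_one]; omega
    rw [e]; exact hu
  | succ n =>
    have e : (pl * 16 + u) / 16 ^ (n + 1) = pl / 16 ^ n := by
      rw [pow_succ', ← Nat.div_div_eq_div_mul, show (pl * 16 + u) / 16 = pl by omega]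
    rw [e] at hn ⊢; exact h n hn

/-- The lowest digit. -/
theorem allDig_head {P : ℕ → Prop} {pl : ℕ} (h : AllDig P pl) (h0 : pl ≠ 0) : P (pl % 16) := by simpa using h 0 (by simpa using h0)

/-- Dropping the lowest digit. -/
theorem allDig_tail {P : ℕ → Prop} {pl : ℕ} (h : AllDig P pl) : AllDig P (pl / 16) := by
  intro n hn
  have e : pl / 16 / 16 ^ n = pl / 16 ^ (n + 1) := by rw [pow_succ', ← Nat.div_div_eq_div_mul]
  rw [e] at hn ⊢; exact h (n + 1) hn

/-- The recursion inside `nibFold`, with explicit fuel. -/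
noncomputable def nibRec (f : ℕ → ℕ → ℕ) (fuel pl acc : ℕ) : ℕ :=
  @Nat.rec (fun _ => ℕ → ℕ → ℕ) (fun _ acc => acc)
    (fun _ ih pl acc => cnd (Nat.beq pl 0) acc
      (frc (Nat.mod pl 16) fun v => frc (f v acc) fun acc' => ih (Nat.div pl 16) acc')) fuel pl acc

/-- `nibFold` is `nibRec` with fuel `64`. -/
theorem nibFold_eq (pl init : ℕ) (f : ℕ → ℕ → ℕ) : nibFold pl init f = nibRec f 64 pl init := rfl

/-- One step of `nibRec`. -/
theorem nibRec_succ (f : ℕ → ℕ → ℕ) (fuel pl acc : ℕ) :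
    nibRec f (fuel + 1) pl acc = if pl = 0 then acc else nibRec f fuel (pl / 16) (f (pl % 16) acc) := by
  show cnd (Nat.beq pl 0) acc (frc (Nat.mod pl 16) fun v => frc (f v acc) fun acc' => nibRec f fuel (Nat.div pl 16) acc') = _
  simp only [cnd_eq_ite, frc_eq, Nat.beq_eq]; rfl

/-- Invariants survive `nibRec`. -/
theorem nibRec_inv {P : ℕ → Prop} {Q : ℕ → Prop} {f : ℕ → ℕ → ℕ} (hf : ∀ v acc, P v → Q acc → Q (f v acc)) :
    ∀ (fuel pl acc : ℕ), AllDig P pl → Q acc → Q (nibRec f fuel pl acc) := by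
  intro fuel
  induction fuel with
  | zero => intro pl acc _ hQ; exact hQ
  | succ fuel ih =>
    intro pl acc hP hQ
    rw [nibRec_succ]
    split_ifs with h0
    · exact hQ
    · exact ih _ _ (allDig_tail hP) (hf _ _ (allDig_head hP h0) hQ)

/-- **`lamOf` at the true `ψ`.**  If every recorded point is non-zero and either `ψ` or of class `lam ∉ {0, 16}`, then
`lamOf ψ pl ∈ {0, lam}`. -/
theorem lamOf_mem {ψ pl lam : ℕ} (hl0 : lam ≠ 0) (hl16 : lam ≠ 16)
    (h : AllDig (fun v => v ≠ 0 ∧ (v = ψ ∨ rep v ψ = lam)) pl) : lamOf ψ pl = 0 ∨ lamOf ψ pl = lam := by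
  unfold lamOf; rw [nibFold_eq]
  refine nibRec_inv (P := fun v => v ≠ 0 ∧ (v = ψ ∨ rep v ψ = lam)) (Q := fun acc => acc = 0 ∨ acc = lam) ?_ 64 pl 0 h
    (Or.inl rfl)
  intro v acc hv hacc
  have hacc16 : acc ≠ 16 := by
    rcases hacc with e | e
    · rw [e]; decide
    · rw [e]; exact hl16
  simp only [cnd_eq_ite, frc_eq, Nat.beq_eq]
  rw [if_neg hacc16]
  by_cases hvψ : v = ψ
  · rw [if_pos hvψ]; exact hacc
  · rw [if_neg hvψ, hv.2.resolve_left hvψ]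
    rcases hacc with e | e
    · rw [if_pos e]; exact Or.inr rfl
    · rw [e, if_neg hl0, if_pos rfl]; exact Or.inr rfl

/-! ## Triple summaries at the truth -/

/-- The semantic content of "the recorded points of line `X` lie on line `X` of the frame". -/
def OnLine (X a b c : ℕ) (pl : ℕ) : Prop := AllDig (fun v => v ≠ 0 ∧ v < 16 ∧ onLB X a b c v = true) pl

/-- The loop inside `feasF` with explicit bound. -/
noncomputable def feasRec (p0 p1 p2 m : ℕ) : ℕ :=
  @Nat.rec (fun _ => ℕ) 0 (fun c acc => frc acc fun acc =>
    cnd (Nat.beq (masksAt (Nat.add c 1) p0 p1 p2) 0) acc (Nat.lor acc (bit (Nat.add c 1)))) m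

/-- `feasF` is `feasRec … 15`. -/
theorem feasF_eq (p0 p1 p2 : ℕ) : feasF p0 p1 p2 = feasRec p0 p1 p2 15 := rfl

/-- One step of `feasRec`. -/
theorem feasRec_succ (p0 p1 p2 m : ℕ) : feasRec p0 p1 p2 (m + 1) =
    if masksAt (m + 1) p0 p1 p2 = 0 then feasRec p0 p1 p2 m else Nat.lor (feasRec p0 p1 p2 m) (bit (m + 1)) := by
  show frc (feasRec p0 p1 p2 m) (fun acc => cnd (Nat.beq (masksAt (Nat.add m 1) p0 p1 p2) 0) acc
    (Nat.lor acc (bit (Nat.add m 1)))) = _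
  simp only [frc_eq, cnd_eq_ite, Nat.beq_eq]

/-- Semantics of `feasRec`: below `2¹⁶`, and bit `k` set iff `1 ≤ k ≤ m ∧ masksAt k ≠ 0` (`m ≤ 15`). -/
theorem feasRec_spec (p0 p1 p2 : ℕ) : ∀ m, m ≤ 15 → feasRec p0 p1 p2 m < 2 ^ 16 ∧
    ∀ k, Mem (feasRec p0 p1 p2 m) k ↔ 1 ≤ k ∧ k ≤ m ∧ masksAt k p0 p1 p2 ≠ 0 := by
  intro m
  induction m with
  | zero =>
    intro _
    refine ⟨by show (0 : ℕ) < 2 ^ 16; norm_num, fun k => ⟨fun h => absurd h (by simp [Mem, feasRec]), ?_⟩⟩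
    rintro ⟨h1, h2, -⟩; omega
  | succ m ih =>
    intro hm
    obtain ⟨ihb, ihk⟩ := ih (Nat.le_of_succ_le hm)
    rw [feasRec_succ]
    split_ifs with hz
    · refine ⟨ihb, fun k => ?_⟩
      rw [ihk]
      constructor
      · rintro ⟨h1, h2, h3⟩; exact ⟨h1, Nat.le_succ_of_le h2, h3⟩
      · rintro ⟨h1, h2, h3⟩
        rcases Nat.lt_or_eq_of_le h2 with h2 | rfl
        · exact ⟨h1, Nat.lt_succ_iff.1 h2, h3⟩
        · exact absurd hz h3
    · refine ⟨?_, fun k => ?_⟩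
      · rw [bit_eq]; exact Nat.or_lt_two_pow ihb (Nat.pow_lt_pow_right (by norm_num) (by omega))
      · rw [mem_lor, ihk, mem_bit]
        constructor
        · rintro (⟨h1, h2, h3⟩ | rfl)
          · exact ⟨h1, Nat.le_succ_of_le h2, h3⟩
          · exact ⟨Nat.succ_le_succ (Nat.zero_le _), le_rfl, hz⟩
        · rintro ⟨h1, h2, h3⟩
          rcases Nat.lt_or_eq_of_le h2 with h2 | h2
          · exact Or.inl ⟨h1, Nat.lt_succ_iff.1 h2, h3⟩
          · exact Or.inr h2

/-- Semantics of `feasF`: below `2¹⁶`, and bit `k` set iff `1 ≤ k ≤ 15 ∧ masksAt k ≠ 0`. -/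
theorem feasF_spec (p0 p1 p2 : ℕ) : feasF p0 p1 p2 < 65536 ∧
    ∀ k, Mem (feasF p0 p1 p2) k ↔ 1 ≤ k ∧ k ≤ 15 ∧ masksAt k p0 p1 p2 ≠ 0 := by
  rw [feasF_eq]; exact feasRec_spec p0 p1 p2 15 le_rfl

/-- Field extraction from `tiPack`. -/
theorem tiPack_fields {M ψ F : ℕ} (hM : M < 281474976710656) (hψ : ψ < 16) (hF : F < 65536) :
    tiM0 (tiPack M ψ F) = M % 65536 ∧ tiM1 (tiPack M ψ F) = M / 65536 % 65536 ∧
      tiM2 (tiPack M ψ F) = M / 4294967296 % 65536 ∧ tiPsi (tiPack M ψ F) = ψ ∧ tiF (tiPack M ψ F) = F := by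
  refine ⟨?_, ?_, ?_, ?_, ?_⟩
  · show (M + ψ * 281474976710656 + F * 4503599627370496 + 295147905179352825856) % 65536 = M % 65536; omega
  · show (M + ψ * 281474976710656 + F * 4503599627370496 + 295147905179352825856) / 65536 % 65536 = M / 65536 % 65536
    omega
  · show (M + ψ * 281474976710656 + F * 4503599627370496 + 295147905179352825856) / 4294967296 % 65536 =
      M / 4294967296 % 65536
    omega
  · show (M + ψ * 281474976710656 + F * 4503599627370496 + 295147905179352825856) / 281474976710656 % 16 = ψ; omega
  · show (M + ψ * 281474976710656 + F * 4503599627370496 + 295147905179352825856) / 4503599627370496 % 65536 = F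
    omega

/-- A summary with a feasible point is alive. -/
theorem ne_zero_of_mem_tiF {r x : ℕ} (h : Mem (tiF r) x) : r ≠ 0 := by
  rintro rfl
  have e : tiF 0 = 0 := rfl
  rw [e] at h
  simp [Mem] at h

/-- `Nat.beq` of unequal numbers. -/
theorem beq_false_of_ne {x y : ℕ} (h : x ≠ y) : Nat.beq x y = false := by
  cases e : Nat.beq x y with
  | false => rfl
  | true => exact absurd (Nat.eq_of_beq_eq_true e) h

/-- `tripInfo` with unknown `ψ`: the engine text. -/
theorem tripInfo_zero_raw (p0 p1 p2 : ℕ) : tripInfo 0 p0 p1 p2 =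
    (frc (feasF p0 p1 p2) fun F =>
      cnd (Nat.beq F 0) 0
        (cnd (Nat.beq (popc16 F) 1)
          (frc (someBit F) fun ψ' => frc (masksAt ψ' p0 p1 p2) fun r => tiPack (Nat.mod r 281474976710656) ψ' F)
          (tiPack allM 0 F))) := rfl

/-- `tripInfo` with unknown `ψ`, unfolded at a named feasible mask `F` (Boolean conditions kept as `cnd`). -/
theorem tripInfo_zero {p0 p1 p2 F : ℕ} (hF : feasF p0 p1 p2 = F) : tripInfo 0 p0 p1 p2 =
    cnd (Nat.beq F 0) 0 (cnd (Nat.beq (popc16 F) 1)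
      (tiPack (Nat.mod (masksAt (someBit F) p0 p1 p2) 281474976710656) (someBit F) F) (tiPack allM 0 F)) := by
  rw [tripInfo_zero_raw, hF, frc_eq]; simp only [frc_eq]

/-- `tripInfo` with known `ψ`: the engine text. -/
theorem tripInfo_pos_raw {ψ : ℕ} (hψ : ψ ≠ 0) (p0 p1 p2 : ℕ) : tripInfo ψ p0 p1 p2 =
    (frc (masksAt ψ p0 p1 p2) fun r => cnd (Nat.beq r 0) 0 (tiPack (Nat.mod r 281474976710656) ψ (bit ψ))) := by
  show cnd (Nat.beq ψ 0) _ _ = _; rw [beq_false_of_ne hψ]; rfl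

/-- `tripInfo` with known `ψ`, unfolded at a named `r = masksAt ψ …`. -/
theorem tripInfo_pos {ψ : ℕ} (hψ : ψ ≠ 0) {p0 p1 p2 r : ℕ} (hr : masksAt ψ p0 p1 p2 = r) : tripInfo ψ p0 p1 p2 =
    cnd (Nat.beq r 0) 0 (tiPack (Nat.mod r 281474976710656) ψ (bit ψ)) := by
  rw [tripInfo_pos_raw hψ, hr, frc_eq]

/-- All fifteen points are in `allPts`. -/
theorem mem_allPts {u : ℕ} (h1 : 1 ≤ u) (h2 : u < 16) : Mem allPts u := by
  unfold Mem allPts; interval_cases u <;> decide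

/-- Fields of `allM`. -/
theorem allM_fields : allM % 65536 = allPts ∧ allM / 65536 % 65536 = allPts ∧ allM / 4294967296 % 65536 = allPts ∧
    allM < 281474976710656 := by unfold allM allPts; decide

/-- **Soundness of the triple summary at the truth.**  Frame `(a,b,c)` independent, recorded `ψ` equal to `0` or the true `ψ`,
recorded points on the true lines.  Then `tripInfo` is alive; its `ψ'` is `0` or the true `ψ`; the true `ψ` is feasible; and every
point `u` of the true line `X` is admissible on line `X`. -/
theorem tripInfo_sound {a b c : ℕ} (ha : a < 16) (hb : b < 16) (hc : c < 16) (hi : indepB a b c = true)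
    {ψ0 p0 p1 p2 : ℕ} (hψ0 : ψ0 = 0 ∨ ψ0 = psiB a b c) (hp0 : OnLine 0 a b c p0) (hp1 : OnLine 1 a b c p1)
    (hp2 : OnLine 2 a b c p2) :
    let r := tripInfo ψ0 p0 p1 p2
    r ≠ 0 ∧ (tiPsi r = 0 ∨ tiPsi r = psiB a b c) ∧ Mem (tiF r) (psiB a b c) ∧
      ∀ u, u < 16 → (onLB 0 a b c u = true → Mem (tiM0 r) u) ∧ (onLB 1 a b c u = true → Mem (tiM1 r) u) ∧
        (onLB 2 a b c u = true → Mem (tiM2 r) u) := by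
  intro r
  obtain ⟨hψne, hψlt, -, -, -⟩ := psiB_spec ha hb hc hi
  obtain ⟨⟨l0ne, l0lt⟩, ⟨l1ne, l1lt⟩, ⟨l2ne, l2lt⟩⟩ := lamTB_spec ha hb hc hi
  -- the three `lamOf` at the true ψ are `0` or the true representative
  have hlam : ∀ X pX, X < 3 → OnLine X a b c pX →
      lamOf (psiB a b c) pX = 0 ∨ lamOf (psiB a b c) pX = lamTB X a b c := by
    intro X pX hX hpX
    have hne : lamTB X a b c ≠ 0 := by interval_cases X; exacts [l0ne, l1ne, l2ne]
    have hlt : lamTB X a b c < 16 := by interval_cases X; exacts [l0lt, l1lt, l2lt]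
    refine lamOf_mem hne (by omega) fun n hn => ?_
    obtain ⟨hv0, hv16, hon⟩ := hpX n hn
    refine ⟨hv0, ?_⟩
    by_cases hvψ : pX / 16 ^ n % 16 = psiB a b c
    · exact Or.inl hvψ
    · exact Or.inr (rep_eq_lamTB ha hb hc hi hX hv16 hon hvψ)
  -- hence masksAt at the true ψ is a `masksCore` at a pattern
  have hcore : ∃ e0 e1 e2, e0 < 2 ∧ e1 < 2 ∧ e2 < 2 ∧ masksAt (psiB a b c) p0 p1 p2 =
      masksCore (psiB a b c) (e0 * lamTB 0 a b c) (e1 * lamTB 1 a b c) (e2 * lamTB 2 a b c) := by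
    rw [masksAt_eq]
    rcases hlam 0 p0 (by norm_num) hp0 with e0 | e0 <;> rcases hlam 1 p1 (by norm_num) hp1 with e1 | e1 <;>
      rcases hlam 2 p2 (by norm_num) hp2 with e2 | e2 <;> rw [e0, e1, e2]
    · exact ⟨0, 0, 0, by norm_num, by norm_num, by norm_num, by simp⟩
    · exact ⟨0, 0, 1, by norm_num, by norm_num, by norm_num, by simp⟩
    · exact ⟨0, 1, 0, by norm_num, by norm_num, by norm_num, by simp⟩
    · exact ⟨0, 1, 1, by norm_num, by norm_num, by norm_num, by simp⟩
    · exact ⟨1, 0, 0, by norm_num, by norm_num, by norm_num, by simp⟩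
    · exact ⟨1, 0, 1, by norm_num, by norm_num, by norm_num, by simp⟩
    · exact ⟨1, 1, 0, by norm_num, by norm_num, by norm_num, by simp⟩
    · exact ⟨1, 1, 1, by norm_num, by norm_num, by norm_num, by simp⟩
  obtain ⟨e0, e1, e2, he0, he1, he2, hma⟩ := hcore
  obtain ⟨hr0, hrlt, hs0, hs1, hs2⟩ := masksCore_spec ha hb hc hi he0 he1 he2
  rw [← hma] at hr0 hrlt hs0 hs1 hs2
  -- the masks of the true ψ contain the lines
  have hlines : ∀ u, u < 16 → ∀ M, M % 281474976710656 = masksAt (psiB a b c) p0 p1 p2 % 281474976710656 →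
      (onLB 0 a b c u = true → Mem (M % 65536) u) ∧ (onLB 1 a b c u = true → Mem (M / 65536 % 65536) u) ∧
        (onLB 2 a b c u = true → Mem (M / 4294967296 % 65536) u) := by
    intro u hu M hM
    have e1 : M % 65536 = masksAt (psiB a b c) p0 p1 p2 % 65536 := by omega
    have e2 : M / 65536 % 65536 = masksAt (psiB a b c) p0 p1 p2 / 65536 % 65536 := by omega
    have e3 : M / 4294967296 % 65536 = masksAt (psiB a b c) p0 p1 p2 / 4294967296 % 65536 := by omega
    rw [e1, e2, e3]
    exact ⟨fun h => mem_of_subMask hs0 (mem_lineSetB hu h), fun h => mem_of_subMask hs1 (mem_lineSetB hu h),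
      fun h => mem_of_subMask hs2 (mem_lineSetB hu h)⟩
  obtain ⟨hFlt, hFmem⟩ := feasF_spec p0 p1 p2
  have hψF : Mem (feasF p0 p1 p2) (psiB a b c) := (hFmem _).2 ⟨Nat.one_le_iff_ne_zero.2 hψne, by omega, hr0⟩
  rcases hψ0 with rfl | rfl
  · -- unknown ψ
    have hF0 : feasF p0 p1 p2 ≠ 0 := ne_zero_of_mem hψF
    by_cases hc1 : popc16 (feasF p0 p1 p2) = 1
    · -- forced: someBit = true ψ
      have hsb : someBit (feasF p0 p1 p2) = psiB a b c := someBit_eq_of_popc16 hFlt hc1 hψlt hψF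
      have hr : r = tiPack (masksAt (psiB a b c) p0 p1 p2 % 281474976710656) (psiB a b c) (feasF p0 p1 p2) := by
        show tripInfo 0 p0 p1 p2 = _
        rw [tripInfo_zero rfl, beq_false_of_ne hF0, cnd_false, show Nat.beq (popc16 (feasF p0 p1 p2)) 1 = true by
          rw [hc1]; rfl, cnd_true, hsb]; rfl
      obtain ⟨f0, f1, f2, fψ, fF⟩ := tiPack_fields (M := masksAt (psiB a b c) p0 p1 p2 % 281474976710656)
        (Nat.mod_lt _ (by norm_num)) hψlt hFlt
      have hF' : Mem (tiF r) (psiB a b c) := by rw [hr, fF]; exact hψF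
      refine ⟨ne_zero_of_mem_tiF hF', ?_, hF', ?_⟩
      · rw [hr, fψ]; exact Or.inr rfl
      · rw [hr, f0, f1, f2]; exact fun u hu => hlines u hu _ (Nat.mod_mod_of_dvd _ (by norm_num))
    · have hr : r = tiPack allM 0 (feasF p0 p1 p2) := by
        show tripInfo 0 p0 p1 p2 = _
        rw [tripInfo_zero rfl, beq_false_of_ne hF0, cnd_false, beq_false_of_ne hc1, cnd_false]
      obtain ⟨a1, a2, a3, a4⟩ := allM_fields
      obtain ⟨f0, f1, f2, fψ, fF⟩ := tiPack_fields (M := allM) (ψ := 0) a4 (by norm_num) hFlt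
      have hF' : Mem (tiF r) (psiB a b c) := by rw [hr, fF]; exact hψF
      refine ⟨ne_zero_of_mem_tiF hF', by rw [hr, fψ]; exact Or.inl rfl, hF', fun u hu => ?_⟩
      rw [hr, f0, f1, f2, a1, a2, a3]
      have hall : ∀ X, onLB X a b c u = true → Mem allPts u := fun X h => by
        refine mem_allPts (Nat.one_le_iff_ne_zero.2 ?_) hu
        unfold onLB at h; simp only [Bool.and_eq_true, Bool.not_eq_true'] at h
        exact Nat.ne_of_beq_eq_false h.1
      exact ⟨hall 0, hall 1, hall 2⟩
  · -- known ψ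
    have hr : r = tiPack (masksAt (psiB a b c) p0 p1 p2 % 281474976710656) (psiB a b c) (bit (psiB a b c)) := by
      show tripInfo (psiB a b c) p0 p1 p2 = _; rw [tripInfo_pos hψne rfl, beq_false_of_ne hr0, cnd_false]; rfl
    have hbit : bit (psiB a b c) < 65536 := by
      rw [bit_eq]; exact lt_of_lt_of_le (Nat.pow_lt_pow_right (by norm_num) hψlt) (by norm_num)
    obtain ⟨f0, f1, f2, fψ, fF⟩ := tiPack_fields (M := masksAt (psiB a b c) p0 p1 p2 % 281474976710656)
      (Nat.mod_lt _ (by norm_num)) hψlt hbit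
    have hF' : Mem (tiF r) (psiB a b c) := by rw [hr, fF]; exact mem_bit.2 rfl
    refine ⟨ne_zero_of_mem_tiF hF', by rw [hr, fψ]; exact Or.inr rfl, hF', ?_⟩
    rw [hr, f0, f1, f2]; exact fun u hu => hlines u hu _ (Nat.mod_mod_of_dvd _ (by norm_num))

end IcosetW

end Summit.MatrixMultiplication.OmegaCensus
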